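import Summits.ResolutionOfSingularities.ResolutionOfSingularities.Theorems.PurelyInseparableDim4JointTwoHostsCharts
import Summits.ResolutionOfSingularities.ResolutionOfSingularities.Theorems.PurelyInseparableDim4JointForestRootWaitingHosts
import HarnessLib

/-!
# Purely inseparable four-folds: TWO HOSTS, EACH WITH ITS OWN WAITING MEMBER, CERTIFIED through the several-hosts root theorem —
# `z^p + (x₁^{2p} − x₁^p) x₄ + (x₁² − x₁) x₂^{p−1} x₃^{p−1}`, every `p` (brick S3 (c) «joint point∘coordinate chains», part 57 = instance
# inst₁₆; cell `res-dim4-pi`)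

[OURS · counted 0] (D-0157 DOOR 2; desk WORD #66 (4)(c), #74 (g), #99 (d); frame `PIDim4.TerminationImpliesOrderReduction`, S3 (c) v3;
host item stmt-ResolutionOfSingularities-16155, helper). Nothing here proves resolution of singularities in dimension ≥ 4 / characteristic
`p` — NOT here, not anywhere in this programme.

THE FIRST CERTIFICATE THAT NEEDS THE THREADING CHAIN (parts 49–55): the order-`p` locus of `z^p + F`,
`F = x₁^{2p} x₄ − x₁^p x₄ + x₁² x₂^{p−1} x₃^{p−1} − x₁ x₂^{p−1} x₃^{p−1}`, is the union of the two DISJOINT surfaces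
`H₁ = V(z, x₁, x₂)`, `H₂ = V(z, x₁ − 1, x₂)` (the hosts, `S = {x₁, x₂}`, `b = 0` resp. `e₁`) and the two surfaces `W₁ = V(z, x₁, x₃)`,
`W₂ = V(z, x₁ − 1, x₃)` (`W_k` meets `H_k` only; waiting entry `(x₂, 0, {x₁, x₃})` on each host; regions `{x₁ = 0, x₃ = 0}` resp.
`{x₁ = 1, x₃ = 0}`). Part 55's hypotheses are discharged from parts 57a/57b: each host's `x₁`-chart is dead, its `x₂`-chart's
equimultiple points lie on the waiting kid, whose own blow-up is dead on both charts; hosts, regions and hosts-vs-regions are separated by the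
parameter `x₁ ∈ {0, 1}`; no isolated points. Neither host's subtree could be certified by the single-host theorems 38/42b (the other host
is not dead: it carries a waiting member).

* **`exists_isMarkedResolution_inst₁₆`**.

AI-produced formalisation, weaker than expert review. bears_on: LADDER-RESOLUTION:D157-DOOR2 (res-dim4-pi · S3 (c) joint v3 · instance).
-/

set_option linter.dupNamespace false -- D-0017: single-problem summit path `Summit.<S>.<S>.…` by design

noncomputable section

open MvPolynomial Finset CategoryTheory AlgebraicGeometry Opposite TopologicalSpace
open AlgebraicGeometry.Scheme.IdealSheafData (ofIdealTop vanishingIdeal)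

namespace Summit.ResolutionOfSingularities.ResolutionOfSingularities.Theorems.PIDim4

open Literature.AlgebraicGeometry.Resolution
open Literature.AlgebraicGeometry.Resolution.Hauser2010
open Literature.AlgebraicGeometry.Resolution.AffinePointBlowup (P A γ coord Wtop ξ)

namespace Equimultiple

section Instance₁₆

variable {K : Type} [Field K] {p : ℕ} [hp : Fact p.Prime] [CharP K p]

/-- **TWO HOSTS WITH WAITING MEMBERS, CERTIFIED** (every `p`). See the module docstring.
[cite: BierstoneGrigorievMilmanWlodarczyk2011, Def. 3.1.3] [cite: HauserPerlega2019PRIMS, §2 (permissible centres P = (z, x_i : i ∈ Γ))]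
[cite: Hauser2010, §F (equiconstant points)] -/
theorem exists_isMarkedResolution_inst₁₆ [IsAlgClosed K] [DecidableEq K] :
    ∃ (X' : Scheme.{0}) (ρ : X' ⟶ P 4 K) (M' : MarkedIdeal X'),
      IsMarkedResolution (⟨hypSheaf p (X 0 ^ (2 * p) * X 3 + C (-1) * (X 0 ^ p * X 3) + X 0 ^ 2 * X 1 ^ (p - 1) * X 2 ^ (p - 1) +
        C (-1) * (X 0 * X 1 ^ (p - 1) * X 2 ^ (p - 1)) : MvPolynomial (Fin 4) K), [], p⟩ : MarkedIdeal (P 4 K)) ρ M' := by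
  classical
  set F : MvPolynomial (Fin 4) K := X 0 ^ (2 * p) * X 3 + C (-1) * (X 0 ^ p * X 3) + X 0 ^ 2 * X 1 ^ (p - 1) * X 2 ^ (p - 1) +
    C (-1) * (X 0 * X 1 ^ (p - 1) * X 2 ^ (p - 1)) with hFdef
  -- the hosts, the waiting entry, the rules below (nothing planned, no leaves)
  set h₁ : (Fin 4 → K) × Finset (Fin 4) := ((0 : Fin 4 → K), ({0, 1} : Finset (Fin 4))) with hh₁
  set h₂ : (Fin 4 → K) × Finset (Fin 4) := ((Pi.single 0 1 : Fin 4 → K), ({0, 1} : Finset (Fin 4))) with hh₂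
  have hne : h₁ ≠ h₂ := fun h => by
    have := congrFun (congrArg Prod.fst h) 0
    simp [hh₁, hh₂] at this
  set wt₀ : Fin 4 × (Fin 4 → K) × Finset (Fin 4) := ((1 : Fin 4), (0 : Fin 4 → K), ({0, 2} : Finset (Fin 4))) with hwt₀
  let plan : State K → Finset (Fin 4) → Finset (Fin 4 × (Fin 4 → K) × Finset (Fin 4)) := fun _ _ => ∅
  let leaves : State K → Finset (Fin 4) → Finset (Fin 4 × (Fin 4 → K)) := fun _ _ => ∅
  have hreach : ∀ q₀ q : State K × Finset (Fin 4),
      Relation.ReflTransGen (fun q q' : State K × Finset (Fin 4) =>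
        ∃ e ∈ plan q.1 q.2, q' = (CentreBlowup.step p q.2 e.1 e.2.1 q.1, e.2.2)) q₀ q → q = q₀ := by
    intro q₀ q hq
    induction hq with
    | refl => rfl
    | tail _ hR _ =>
      obtain ⟨e, he, -⟩ := hR
      exact absurd he (Finset.notMem_empty e)
  have hacc : ∀ q : State K × Finset (Fin 4), Acc (fun q' q : State K × Finset (Fin 4) =>
      ∃ e ∈ plan q.1 q.2, q' = (CentreBlowup.step p q.2 e.1 e.2.1 q.1, e.2.2)) q := fun q =>
    Acc.intro _ fun q' ⟨e, he, _⟩ => absurd he (Finset.notMem_empty e)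
  -- the state table
  let hst : (Fin 4 → K) × Finset (Fin 4) → State K := fun bS => ⟨deletePthPowers p (PointBlowup.translate bS.1 F), 0, ∅⟩
  have hst₁ : hst h₁ = ⟨X 0 ^ (2 * p) * X 3 + C (-1) * (X 0 ^ p * X 3) + X 0 ^ 2 * X 1 ^ (p - 1) * X 2 ^ (p - 1) +
      C (-1) * (X 0 * X 1 ^ (p - 1) * X 2 ^ (p - 1)), 0, ∅⟩ := by
    show (⟨deletePthPowers p (PointBlowup.translate (0 : Fin 4 → K) F), 0, ∅⟩ : State K) = _
    rw [PointBlowup.translate_zero, hFdef,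
      Literature.Barriers.ResolutionOfSingularities.HauserPerlega.deletePthPowers_eq_self (isClean_twoHosts _)]
  have hst₂ : hst h₂ = ⟨X 0 ^ (2 * p) * X 3 + C 1 * (X 0 ^ p * X 3) + X 0 ^ 2 * X 1 ^ (p - 1) * X 2 ^ (p - 1) +
      C 1 * (X 0 * X 1 ^ (p - 1) * X 2 ^ (p - 1)), 0, ∅⟩ := by
    show (⟨deletePthPowers p (PointBlowup.translate (Pi.single 0 1 : Fin 4 → K) F), 0, ∅⟩ : State K) = _
    rw [hFdef, translate_e₀_twoHosts,
      Literature.Barriers.ResolutionOfSingularities.HauserPerlega.deletePthPowers_eq_self (isClean_twoHosts _)]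
  -- the per-host block, uniformly in `ε ≠ 0`
  have hostblock : ∀ ε : K, ε ≠ 0 → ∀ s : State K,
      s.F = X 0 ^ (2 * p) * X 3 + C ε * (X 0 ^ p * X 3) + X 0 ^ 2 * X 1 ^ (p - 1) * X 2 ^ (p - 1) +
        C ε * (X 0 * X 1 ^ (p - 1) * X 2 ^ (p - 1)) →
      IsPermissibleCentre p ({0, 1} : Finset (Fin 4)) s.F ∧ OwnBlock p plan leaves {wt₀} (s, ({0, 1} : Finset (Fin 4))) ∧
      (∀ q : State K × Finset (Fin 4),
        ((∃ e ∈ plan s ({0, 1} : Finset (Fin 4)), Relation.ReflTransGen (fun q q' : State K × Finset (Fin 4) =>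
            ∃ e ∈ plan q.1 q.2, q' = (CentreBlowup.step p q.2 e.1 e.2.1 q.1, e.2.2))
            (CentreBlowup.step p ({0, 1} : Finset (Fin 4)) e.1 e.2.1 s, e.2.2) q) ∨
          ∃ wt ∈ ({wt₀} : Finset (Fin 4 × (Fin 4 → K) × Finset (Fin 4))),
            Relation.ReflTransGen (fun q q' : State K × Finset (Fin 4) =>
              ∃ e ∈ plan q.1 q.2, q' = (CentreBlowup.step p q.2 e.1 e.2.1 q.1, e.2.2))
              (CentreBlowup.step p ({0, 1} : Finset (Fin 4)) wt.1 wt.2.1 s, wt.2.2) q) →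
        V2Block p plan leaves q) ∧
      Acc (fun q' q : State K × Finset (Fin 4) => ∃ e ∈ plan q.1 q.2, q' = (CentreBlowup.step p q.2 e.1 e.2.1 q.1, e.2.2))
        (s, ({0, 1} : Finset (Fin 4))) ∧
      (∀ wt ∈ ({wt₀} : Finset (Fin 4 × (Fin 4 → K) × Finset (Fin 4))), wt.1 ∈ ({0, 1} : Finset (Fin 4)) ∧
        (∀ i ∈ ({0, 1} : Finset (Fin 4)), wt.2.1 i = 0) ∧ ({0, 1} : Finset (Fin 4)).erase wt.1 ⊆ wt.2.2 ∧ wt.1 ∉ wt.2.2 ∧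
        IsPermissibleCentre p wt.2.2 (PointBlowup.translate wt.2.1 s.F) ∧
        Acc (fun q' q : State K × Finset (Fin 4) => ∃ e ∈ plan q.1 q.2, q' = (CentreBlowup.step p q.2 e.1 e.2.1 q.1, e.2.2))
          (CentreBlowup.step p ({0, 1} : Finset (Fin 4)) wt.1 wt.2.1 s, wt.2.2)) ∧
      (∀ wt ∈ ({wt₀} : Finset (Fin 4 × (Fin 4 → K) × Finset (Fin 4))), ∀ wt' ∈ ({wt₀} : Finset (Fin 4 × (Fin 4 → K) × Finset (Fin 4))),
        wt ≠ wt' → wt.1 = wt'.1 → ∃ i ∈ wt.2.2, i ∈ wt'.2.2 ∧ wt.2.1 i ≠ wt'.2.1 i) ∧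
      (∀ e ∈ plan s ({0, 1} : Finset (Fin 4)), ∀ wt ∈ ({wt₀} : Finset (Fin 4 × (Fin 4 → K) × Finset (Fin 4))),
        e.1 = wt.1 → ∃ i ∈ e.2.2, i ∈ wt.2.2 ∧ e.2.1 i ≠ wt.2.1 i) := by
    intro ε hε s hs
    have hH : (CentreBlowup.step p ({0, 1} : Finset (Fin 4)) 1 (0 : Fin 4 → K) s).F =
        C 1 * (X 0 ^ (2 * p) * X 1 ^ p * X 2 ^ 0 * X 3 ^ 1) + C ε * (X 0 ^ p * X 1 ^ 0 * X 2 ^ 0 * X 3 ^ 1) +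
          C 1 * (X 0 ^ 2 * X 1 ^ 1 * X 2 ^ (p - 1) * X 3 ^ 0) + C ε * (X 0 ^ 1 * X 1 ^ 0 * X 2 ^ (p - 1) * X 3 ^ 0) := by
      show deletePthPowers p (PointBlowup.translate (0 : Fin 4 → K)
        (CentreBlowup.chartTransform p ({0, 1} : Finset (Fin 4)) 1 s.F)) = _
      rw [hs, chartTransform_S1_twoHosts hp.out.one_lt.le, PointBlowup.translate_zero]
      exact Literature.Barriers.ResolutionOfSingularities.HauserPerlega.deletePthPowers_eq_self (isClean_H_twoHosts ε)
    refine ⟨by rw [hs]; exact isPermissibleCentre_S_twoHosts ε, ⟨fun e he => absurd he (Finset.notMem_empty e),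
      fun e he => absurd he (Finset.notMem_empty e), fun l hl => absurd hl (Finset.notMem_empty l),
      fun j' b' hj' hb' _ heq => ?_⟩, fun q hq => ?_, hacc _, fun wt hwt => ?_, fun wt hwt wt' hwt' hne' => ?_,
      fun e he => absurd he (Finset.notMem_empty e)⟩
    · -- the three-way cover over the host: chart `x₁` dead, chart `x₂` on the waiting kid
      rcases Finset.mem_insert.mp hj' with rfl | hj'
      · exact absurd heq (not_isEquimultiplePoint_S0_twoHosts hε b' hb' s hs)
      · rw [Finset.mem_singleton] at hj'
        subst hj'
        obtain ⟨h0, h2⟩ := cases_S1_twoHosts hε s hs heq hb'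
        refine Or.inr (Or.inl ⟨wt₀, Finset.mem_singleton_self _, rfl, fun i hi => ?_⟩)
        change i ∈ ({0, 2} : Finset (Fin 4)) at hi
        rcases Finset.mem_insert.mp hi with rfl | hi
        · rw [h0]; rfl
        · rw [Finset.mem_singleton] at hi
          subst hi
          rw [h2]; rfl
    · -- below the waiting kid: both charts dead
      rcases hq with ⟨e, he, -⟩ | ⟨wt, hwt, hq⟩
      · exact absurd he (Finset.notMem_empty e)
      · rw [Finset.mem_singleton] at hwt
        subst hwt
        have hqw := hreach _ q hq
        subst hqw
        refine ⟨fun e he => absurd he (Finset.notMem_empty e), fun e he => absurd he (Finset.notMem_empty e),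
          fun l hl => absurd hl (Finset.notMem_empty l), fun j'' b'' hj'' hb'' _ heq => ?_⟩
        change j'' ∈ ({0, 2} : Finset (Fin 4)) at hj''
        rcases Finset.mem_insert.mp hj'' with rfl | hj''
        · exact absurd heq (not_isEquimultiplePoint_T0_twoHosts hε b'' hb'' _ hH)
        · rw [Finset.mem_singleton] at hj''
          subst hj''
          exact absurd heq (not_isEquimultiplePoint_T2_twoHosts hε b'' hb'' _ hH)
    · -- the waiting entry in root form
      rw [Finset.mem_singleton] at hwt
      subst hwt
      refine ⟨by simp [hwt₀], fun i _ => rfl, by show (({0, 1} : Finset (Fin 4)).erase 1) ⊆ ({0, 2} : Finset (Fin 4)); decide,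
        by show (1 : Fin 4) ∉ ({0, 2} : Finset (Fin 4)); decide, ?_, hacc _⟩
      change IsPermissibleCentre p ({0, 2} : Finset (Fin 4)) (PointBlowup.translate (0 : Fin 4 → K) s.F)
      rw [PointBlowup.translate_zero, hs]
      exact isPermissibleCentre_T_twoHosts ε
    · -- one waiting entry per host
      rw [Finset.mem_singleton] at hwt hwt'
      exact absurd (hwt.trans hwt'.symm) hne'
  -- which pairs of distinct hosts occur
  have hpairs : ∀ bS ∈ ({h₁, h₂} : Finset ((Fin 4 → K) × Finset (Fin 4))), ∀ bS' ∈ ({h₁, h₂} : Finset ((Fin 4 → K) × Finset (Fin 4))),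
      bS ≠ bS' → (bS = h₁ ∧ bS' = h₂) ∨ (bS = h₂ ∧ bS' = h₁) := by
    intro bS hbS bS' hbS' hbb
    rcases Finset.mem_insert.mp hbS with rfl | hbS <;> rcases Finset.mem_insert.mp hbS' with rfl | hbS'
    · exact absurd rfl hbb
    · rw [Finset.mem_singleton] at hbS'; exact Or.inl ⟨rfl, hbS'⟩
    · rw [Finset.mem_singleton] at hbS; exact Or.inr ⟨hbS, rfl⟩
    · rw [Finset.mem_singleton] at hbS hbS'; exact absurd (hbS.trans hbS'.symm) hbb
  have h10 : h₁.1 0 = 0 := rfl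
  have h20 : h₂.1 0 = 1 := by simp [hh₂]
  have h0S : (0 : Fin 4) ∈ h₁.2 := by simp [hh₁]
  have h0S' : (0 : Fin 4) ∈ h₂.2 := by simp [hh₂]
  have h0T : (0 : Fin 4) ∈ wt₀.2.2 := by simp [hwt₀]
  -- no isolated root points
  have hempty : {b' : Fin 4 → K | (∀ d : Fin 4 →₀ ℕ, d ≠ 0 → d.degree < p →
      coeff d (PointBlowup.translate b' F) = 0) ∧ (∀ bS ∈ ({h₁, h₂} : Finset ((Fin 4 → K) × Finset (Fin 4))),
        ¬ ∀ i ∈ bS.2, b' i = bS.1 i) ∧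
      ∀ bS ∈ ({h₁, h₂} : Finset ((Fin 4 → K) × Finset (Fin 4))), ∀ wt ∈ ({wt₀} : Finset (Fin 4 × (Fin 4 → K) × Finset (Fin 4))),
        ¬ ∀ i ∈ wt.2.2, b' i = bS.1 i + wt.2.1 i} = ∅ := by
    refine Set.eq_empty_of_forall_notMem fun b' ⟨H, hhost, hwait⟩ => ?_
    obtain ⟨h0, h12⟩ := roots_twoHosts b' H
    have hm₁ : h₁ ∈ ({h₁, h₂} : Finset ((Fin 4 → K) × Finset (Fin 4))) := by simp
    have hm₂ : h₂ ∈ ({h₁, h₂} : Finset ((Fin 4 → K) × Finset (Fin 4))) := by simp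
    rcases h0 with h0 | h0 <;> rcases h12 with h1 | h2
    · refine hhost h₁ hm₁ fun i hi => ?_
      change i ∈ ({0, 1} : Finset (Fin 4)) at hi
      rcases Finset.mem_insert.mp hi with rfl | hi
      · rw [h0]; rfl
      · rw [Finset.mem_singleton] at hi; subst hi; rw [h1]; rfl
    · refine hwait h₁ hm₁ wt₀ (Finset.mem_singleton_self _) fun i hi => ?_
      change i ∈ ({0, 2} : Finset (Fin 4)) at hi
      rcases Finset.mem_insert.mp hi with rfl | hi
      · rw [h0]; simp [hh₁, hwt₀]
      · rw [Finset.mem_singleton] at hi; subst hi; rw [h2]; simp [hh₁, hwt₀]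
    · refine hhost h₂ hm₂ fun i hi => ?_
      change i ∈ ({0, 1} : Finset (Fin 4)) at hi
      rcases Finset.mem_insert.mp hi with rfl | hi
      · rw [h0]; simp [hh₂]
      · rw [Finset.mem_singleton] at hi; subst hi; rw [h1]; simp [hh₂]
    · refine hwait h₂ hm₂ wt₀ (Finset.mem_singleton_self _) fun i hi => ?_
      change i ∈ ({0, 2} : Finset (Fin 4)) at hi
      rcases Finset.mem_insert.mp hi with rfl | hi
      · rw [h0]; simp [hh₂, hwt₀]
      · rw [Finset.mem_singleton] at hi; subst hi; rw [h2]; simp [hh₂, hwt₀]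
  refine exists_isMarkedResolution_joint_forest_root_waiting_hosts (p := p) F twoHosts_ne_zero (isClean_twoHosts _) plan leaves
    {h₁, h₂} hst (fun _ _ => rfl) (fun _ => {wt₀}) (fun bS hbS => ?_) (fun bS hbS bS' hbS' hbb => ?_)
    (fun bS hbS bS' hbS' hbb wt hwt => ?_) (fun bS hbS bS' hbS' hbb wt hwt wt' hwt' => ?_) (by rw [hempty]; exact Set.finite_empty)
    (fun b' H hhost hwait => ?_)
  · -- the hosts' data
    rcases Finset.mem_insert.mp hbS with rfl | hbS
    · rw [hst₁]
      exact hostblock (-1) (neg_ne_zero.mpr one_ne_zero) _ rfl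
    · rw [Finset.mem_singleton] at hbS
      subst hbS
      rw [hst₂]
      exact hostblock 1 one_ne_zero _ rfl
  · -- hosts separated on `x₁`
    rcases hpairs bS hbS bS' hbS' hbb with ⟨rfl, rfl⟩ | ⟨rfl, rfl⟩
    · exact ⟨0, h0S, h0S', by rw [h10, h20]; exact zero_ne_one⟩
    · exact ⟨0, h0S', h0S, by rw [h10, h20]; exact one_ne_zero⟩
  · -- a host and the other host's region separated on `x₁`
    rw [Finset.mem_singleton] at hwt
    subst hwt
    rcases hpairs bS hbS bS' hbS' hbb with ⟨rfl, rfl⟩ | ⟨rfl, rfl⟩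
    · exact ⟨0, h0S, h0T, by rw [h10, h20]; simp⟩
    · exact ⟨0, h0S', h0T, by rw [h10, h20]; simp⟩
  · -- the two regions separated on `x₁`
    rw [Finset.mem_singleton] at hwt hwt'
    subst hwt; subst hwt'
    rcases hpairs bS hbS bS' hbS' hbb with ⟨rfl, rfl⟩ | ⟨rfl, rfl⟩
    · exact ⟨0, h0T, h0T, by rw [h10, h20]; simp⟩
    · exact ⟨0, h0T, h0T, by rw [h10, h20]; simp⟩
  · -- no isolated root points
    have hb : b' ∈ ({b' : Fin 4 → K | (∀ d : Fin 4 →₀ ℕ, d ≠ 0 → d.degree < p →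
        coeff d (PointBlowup.translate b' F) = 0) ∧ (∀ bS ∈ ({h₁, h₂} : Finset ((Fin 4 → K) × Finset (Fin 4))),
          ¬ ∀ i ∈ bS.2, b' i = bS.1 i) ∧
        ∀ bS ∈ ({h₁, h₂} : Finset ((Fin 4 → K) × Finset (Fin 4))), ∀ wt ∈ ({wt₀} : Finset (Fin 4 × (Fin 4 → K) × Finset (Fin 4))),
          ¬ ∀ i ∈ wt.2.2, b' i = bS.1 i + wt.2.1 i}) := ⟨H, hhost, hwait⟩
    rw [hempty] at hb
    exact absurd hb (Set.notMem_empty _)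

end Instance₁₆

end Equimultiple

end Summit.ResolutionOfSingularities.ResolutionOfSingularities.Theorems.PIDim4

end
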